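import Summits.QuantumFields.YangMills.Theorems.BalabanUVNodesN19ShapeFaceN14AtRecord
import Summits.QuantumFields.YangMills.Theorems.BalabanUVNodesN14SharpTiltDefectChain

/-!
# BalabanUVNodes ∕ N19 → N14 — THE U3 FACE FOR N14 AT THE RECORD's KEYS, SHARP-RATE EDITION: the same displayed U3 read-out sentence (SHAPE_cl in
# density form, width `r_K`) now gives N14's binder `TiltedMeanMatching … η` at the SHARP rate `η_K = 2B·tanh(r_K∕2)` and the LINEAR rate `η_K = B·r_K`
# (dag-n14-w3 g2's `YMDAG.N14.SharpTilt` engine, p593248 ∕ p594573) in place of this seat's g0 rate `B·(e^{2 r_K} − 1)` — two keys, key levels, and the record's keys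

Cell `pub-ymgap` (HUMAN RULING D-0062 Track A; D-0149 width push, director-ym №197), WIDTH SEAT `pub-ymgap-dag-n19-w2` (g2).  dag-n14-w3 g2's hand-out (pub-ymgap INBOX
l.26584, trigger (t2) «a by-name ask for the sharp ∕ linear rate at other letters — n19-w2's record-keyed `_atKeys` ∕ §3 faces — one `exact` each, theirs to take first»).
Filed `--kind proof --supports stmt-QuantumFields-20544 --as helper` (K3⁷ `SpineGivenEndpointR13SepCoPH`); COUNT-NEUTRAL.  THEOREMS ONLY (0 `def`); imports this seat's
g0 file `…N19ShapeFaceN14AtRecord` (p584343: binder prefixes, `tiltedMean_map` road, MODULE B laws) and dag-n14-w3's `…N14SharpTiltDefectChain` (p594573: the one-space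
sharp engine `tiltedMeanMatching_of_shapeDensity_tanh ∕ _linear`); nothing re-declared.

WHAT IS TYPED (every theorem = the g0 face with the rate letter swapped, by ONE application of the sharp one-space theorem + n14-c's `tiltedMean_map`):
§1 two keys: `tiltedMeanMatching_of_shapeDensity_map₂_tanh` (`η K = 2B·tanh(r K∕2)`) · `…_map₂_linear` (`η K = B·r K`);
§2 key levels of ONE scheme with a unit factorisation (`B = 1`): `tiltedMeanMatching_of_shapeDensity_atKeys_linear` (`η = r`);
§3 the record's keys (module 26's binder prefix VERBATIM, MODULE B's laws `_of_ppSelId`): ★ `tiltedMeanMatching_classMeasureOfSlots_of_shapeDensity_linear` (`η = r`).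
The `∃ η, … ∧ Summable η` PAIRS are NOT re-issued: as STATEMENTS they are the g0 file's `exists_tiltedMeanMatching_summable_of_shapeDensity_map₂` ∕
`exists_tiltedMeanMatching_summable_classMeasureOfSlots_of_shapeDensity` verbatim (the gate's `dedup.landed` guard; the witness `η := B·r` ∕ `η := r` is a one-liner
`⟨_, <the _linear face>, hrs.mul_left B⟩` for any consumer who wants the linear majorant explicitly).
WHY IT MATTERS (numbers): for the summable-majorant slot the rate letter is immaterial (`Σ r < ∞ ⇔ Σ (e^{2r} − 1) < ∞` for `r → 0`), but every QUANTITATIVE use of N14's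
binder downstream (window numerics, the `hybridDelta` bookkeeping of node U5) inherits the constant: `B·r` vs `B·(e^{2r} − 1)` is a factor `(e^{2r} − 1)∕r ≥ 2`, unbounded in `r`;
and dag-n14-w3's `oddsRatio_bound_attained` shows `2·tanh(r∕2)` cannot be improved.

HONEST FRAMING.  [folklore] by-name compositions; ZERO estimate content — `hD` ∕ `hSh` (SHAPE_cl in density form at the keys: the two runs' class measures pushed to the unit
lattice agree class by class up to a constant factor and a log-density of sup `≤ r_K`) is the U3 READ-OUT SENTENCE, produced by nobody; nothing of Bałaban's instantiated; NE7 ∕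
NE1′ NOT PRINTED as two-run statements for d = 4 and NOT proved; N14 ∕ N19 NOT discharged; K3⁷ OPEN, not claimed; counts UNMOVED (typed 28∕28 · discharged 5∕27 (A 5∕28)); no count
claim; one finite 𝕋⁴ programme at fixed ε, Bałaban AS PRINTED; the YM mass gap (Clay) is NOT proved by any of this — R4 closes the conditional finite-𝕋⁴ rung `BalabanLadder.UV`
only; nothing continuum ∕ ℝ⁴ ∕ OS.  No `def`, no `instance`, no `sorry`.
-/

set_option autoImplicit false

noncomputable section

open MeasureTheory ProbabilityTheory
open scoped ENNReal Matrix.Norms.L2Operator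

namespace Summit.QuantumFields.YangMills.BalabanUVNodes.N19ShapeFaceN14AtRecordSharp

open Summit.QuantumFields.BalabanUV.T4Continuum.NE1p.DressedMGFForm (tiltedMean MGFForm TiltedMeanMatching)
open Summit.QuantumFields.YangMills.BalabanUVNodes.N19ClassSandwichAtRecord (prodObs_eq_prodW_comp_A measurable_prodW abs_prodW_le_one)
open Summit.QuantumFields.YangMills.BalabanUVNodes.N19MGFFormAtRecord (mgfForm_classWeightOfDatum₉_of_ppSelId)
open YMDAG.N14.ConvexFibreCauchy (tiltedMean_map)
open YMDAG.N14.SharpTilt (tiltedMeanMatching_of_shapeDensity_tanh tiltedMeanMatching_of_shapeDensity_linear)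
open Literature.MathematicalPhysics.QuantumFieldTheory.Balaban1983to89

/-! ## §1 GENERIC, TWO KEYS — sharp and linear rates -/

section TwoKeys

variable {X : Type*} [MeasurableSpace X] {ΩA ΩB : ℕ → Type*} [∀ K, MeasurableSpace (ΩA K)] [∀ K, MeasurableSpace (ΩB K)]
  {ι : Type*} [DecidableEq ι] {l₀ B : ℝ} {T : ℕ → Finset ι} {Bad : ℕ → ℝ → Finset ι} {φ : X → ℝ}
  {a : ∀ K, ΩA K → X} {b : ∀ K, ΩB K → X}
  {νA : ∀ K, ι → Measure (ΩA K)} {νB : ∀ K, ι → Measure (ΩB K)} {r : ℕ → ℝ}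

/-- **THE U3 FACE FOR N14, TWO KEYS, SHARP RATE** [folklore]: the g0 face `N19ShapeFaceN14AtRecord.tiltedMeanMatching_of_shapeDensity_map₂` (binder prefix VERBATIM) with
the conclusion `TiltedMeanMatching … (K ↦ 2B·tanh(r K∕2))` — dag-n14-w3's one-space `tiltedMeanMatching_of_shapeDensity_tanh` on the pushed-forward class measures + n14-c's
`tiltedMean_map` on both sides. [folklore] -/
theorem tiltedMeanMatching_of_shapeDensity_map₂_tanh (ha : ∀ K, Measurable (a K)) (hb : ∀ K, Measurable (b K)) (hφ : Measurable φ)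
    (hφb : ∀ u, |φ u| ≤ B) (hB : 0 ≤ B) (hfin : ∀ K, ∀ τ ∈ T K, IsFiniteMeasure (νA K τ))
    (hD : ∀ (K : ℕ) (t : ℝ), |t| ≤ l₀ → ∀ τ ∈ T K \ Bad K t, ∃ (c : ℝ) (g : X → ℝ), Measurable g ∧ (∀ x, |g x| ≤ r K) ∧
      (νB K τ).map (b K) = ENNReal.ofReal (Real.exp c) • ((νA K τ).map (a K)).withDensity fun x => ENNReal.ofReal (Real.exp (g x)))
    (hr : ∀ K, 0 ≤ r K) :
    TiltedMeanMatching l₀ T Bad (fun K => φ ∘ a K) νA (fun K => φ ∘ b K) νB fun K => 2 * B * Real.tanh (r K / 2) := by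
  have h := tiltedMeanMatching_of_shapeDensity_tanh (Ω := fun _ => X) (T := T) (Bad := Bad) (l₀ := l₀) (r := r)
    (μA := fun K τ => (νA K τ).map (a K)) (μB := fun K τ => (νB K τ).map (b K)) (W := fun _ => φ)
    hD hr hB (fun K τ hτ => by haveI := hfin K τ hτ; exact Measure.isFiniteMeasure_map (νA K τ) (a K)) (fun _ => hφ) (fun _ x => hφb x)
  intro K t ht τ hτ s hs
  have hK := h K t ht τ hτ s hs
  rw [tiltedMean_map (hb K) hφ, tiltedMean_map (ha K) hφ] at hK
  exact hK

/-- **THE U3 FACE FOR N14, TWO KEYS, LINEAR RATE** [folklore]: the same with `η K = B·r K` (dag-n14-w3's `tiltedMeanMatching_of_shapeDensity_linear`). [folklore] -/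
theorem tiltedMeanMatching_of_shapeDensity_map₂_linear (ha : ∀ K, Measurable (a K)) (hb : ∀ K, Measurable (b K)) (hφ : Measurable φ)
    (hφb : ∀ u, |φ u| ≤ B) (hB : 0 ≤ B) (hfin : ∀ K, ∀ τ ∈ T K, IsFiniteMeasure (νA K τ))
    (hD : ∀ (K : ℕ) (t : ℝ), |t| ≤ l₀ → ∀ τ ∈ T K \ Bad K t, ∃ (c : ℝ) (g : X → ℝ), Measurable g ∧ (∀ x, |g x| ≤ r K) ∧
      (νB K τ).map (b K) = ENNReal.ofReal (Real.exp c) • ((νA K τ).map (a K)).withDensity fun x => ENNReal.ofReal (Real.exp (g x)))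
    (hr : ∀ K, 0 ≤ r K) :
    TiltedMeanMatching l₀ T Bad (fun K => φ ∘ a K) νA (fun K => φ ∘ b K) νB fun K => B * r K := by
  have h := tiltedMeanMatching_of_shapeDensity_linear (Ω := fun _ => X) (T := T) (Bad := Bad) (l₀ := l₀) (r := r)
    (μA := fun K τ => (νA K τ).map (a K)) (μB := fun K τ => (νB K τ).map (b K)) (W := fun _ => φ)
    hD hr hB (fun K τ hτ => by haveI := hfin K τ hτ; exact Measure.isFiniteMeasure_map (νA K τ) (a K)) (fun _ => hφ) (fun _ x => hφb x)
  intro K t ht τ hτ s hs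
  have hK := h K t ht τ hτ s hs
  rw [tiltedMean_map (hb K) hφ, tiltedMean_map (ha K) hφ] at hK
  exact hK

end TwoKeys

/-! ## §2 At general key LEVELS of ONE scheme with a unit factorisation — linear rate (`B = 1`, so `η = r`) -/

section AtKeys

variable {G O : Type*} {S : Missing.TorusScheme G O} [MeasurableSpace G] {X : Type*} [MeasurableSpace X]
  {ι : Type*} [DecidableEq ι] {l₀ : ℝ} {T : ℕ → Finset ι} {Bad : ℕ → ℝ → Finset ι}
  {kA kB : ℕ → ℕ} {νA : ∀ K, ι → Measure (GaugeField (S.P (kA K)) 0 G)} {νB : ∀ K, ι → Measure (GaugeField (S.P (kB K)) 0 G)}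
  {r : ℕ → ℝ}

/-- **THE U3 FACE FOR N14 AT GENERAL KEY LEVELS, LINEAR RATE** [folklore]: the g0 face `…_atKeys` (binder prefix VERBATIM) with the conclusion
`TiltedMeanMatching l₀ T Bad (K ↦ prodObs S (kA K) os) νA (K ↦ prodObs S (kB K) os) νB r` — the string observable is bounded by `1`, so `η = 1·r = r`. [folklore] -/
theorem tiltedMeanMatching_of_shapeDensity_atKeys_linear (N : T4VarianceMatching.UnitFactorisation S X) (os : List O)
    (hfin : ∀ K, ∀ τ ∈ T K, IsFiniteMeasure (νA K τ))
    (hD : ∀ (K : ℕ) (t : ℝ), |t| ≤ l₀ → ∀ τ ∈ T K \ Bad K t, ∃ (c : ℝ) (g : X → ℝ), Measurable g ∧ (∀ x, |g x| ≤ r K) ∧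
      (νB K τ).map (N.A (kB K)) = ENNReal.ofReal (Real.exp c) • ((νA K τ).map (N.A (kA K))).withDensity fun x => ENNReal.ofReal (Real.exp (g x)))
    (hr : ∀ K, 0 ≤ r K) :
    TiltedMeanMatching l₀ T Bad (fun K => T4GenFunBounds.prodObs S (kA K) os) νA (fun K => T4GenFunBounds.prodObs S (kB K) os) νB r := by
  have hA : (fun K => T4GenFunBounds.prodObs S (kA K) os) = fun K => (fun u => (os.map fun o => N.W o u).prod) ∘ N.A (kA K) :=
    funext fun K => prodObs_eq_prodW_comp_A N (kA K) os
  have hB : (fun K => T4GenFunBounds.prodObs S (kB K) os) = fun K => (fun u => (os.map fun o => N.W o u).prod) ∘ N.A (kB K) :=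
    funext fun K => prodObs_eq_prodW_comp_A N (kB K) os
  rw [hA, hB]
  have h := tiltedMeanMatching_of_shapeDensity_map₂_linear (ΩA := fun K => GaugeField (S.P (kA K)) 0 G) (ΩB := fun K => GaugeField (S.P (kB K)) 0 G)
    (a := fun K => N.A (kA K)) (b := fun K => N.A (kB K)) (T := T) (Bad := Bad) (l₀ := l₀) (νA := νA) (νB := νB)
    (fun K => N.measurable_A (kA K)) (fun K => N.measurable_A (kB K))
    (measurable_prodW N os) (abs_prodW_le_one N os) zero_le_one hfin hD hr
  intro K t ht τ hτ s hs
  have hK := h K t ht τ hτ s hs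
  simp only [one_mul] at hK
  exact hK

end AtKeys

/-! ## §3 ★ AT THE RECORD's KEYS — linear rate (module 26's binder prefix verbatim, MODULE B's laws) -/

section AtRecord

open Literature.MathematicalPhysics.QuantumFieldTheory.Balaban1983to89.Node00
open T4Continuum B14.Eq218Concrete
open Summit.QuantumFields.YangMills.BalabanUVNodes.N19MGFKernelTower (classMeasureOfSlots)

variable {F : T4Family} {N : ℕ} [NeZero N] {ι : Type*} [DecidableEq ι] {l₀ : ℝ} {Bad : ℕ → ℝ → Finset ι} {r : ℕ → ℝ}

/-- **★ THE U3 FACE FOR N14 AT THE RECORD's KEYS, LINEAR RATE** [bookkeeping]: the g0 face `tiltedMeanMatching_classMeasureOfSlots_of_shapeDensity` (binder prefix VERBATIM —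
Stage-9 tuple at the identity selector with the displayed `w`∕`χ` laws, datum `D hD g₀ os`, run keys `pA pB gA gB kA kB`, decodings `eA eB`, THE U3 READ-OUT SENTENCE `hSh`) with the
conclusion `TiltedMeanMatching … r` in place of `… (K ↦ e^{2 r K} − 1)`.  ZERO estimate content: `hSh` is the residual (produced by nobody). [folklore] -/
theorem tiltedMeanMatching_classMeasureOfSlots_of_shapeDensity_linear (ϑ : Stage9Params F N) (hsel : ϑ.ppSel = ppSelIdOfRecord F ϑ.ν ϑ.τ9.M)
    (hw0 : ∀ p g k s' U V', 0 ≤ wOfRecord₉ F N ϑ p g k s' U V') (hw1 : ∀ p g k s' U V', wOfRecord₉ F N ϑ p g k s' U V' ≤ 1)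
    (hwm : ∀ (p : B12.RunParams) (g : ℕ → ℝ) k s',
      Measurable fun z : GaugeField (F.P p.K) (k + 1) (SU N) × GaugeField (F.P p.K) k (SU N) => wOfRecord₉ F N ϑ p g k s' z.2 z.1)
    (hχm : ∀ (p : B12.RunParams) (g : ℕ → ℝ) k s, Measurable (chiSeqOfRecord F N ϑ.ν ϑ.τ9.M g p.K k s))
    (D : FiniteEpsData F (SU N)) (hD : D.AvgMeasurable) (g₀ : ℕ → ℝ) (os : List (ULoop F))
    (pA pB : ℕ → B12.RunParams) (gA gB : ℕ → ℕ → ℝ) (kA kB : ℕ → ℕ) (T : ℕ → Finset ι)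
    (eA : ∀ K, ι → SeqOfRecord F ϑ.ν ϑ.τ9.M (gA K) (pA K).K (kA K)) (eB : ∀ K, ι → SeqOfRecord F ϑ.ν ϑ.τ9.M (gB K) (pB K).K (kB K))
    (hSh : ∀ (K : ℕ) (t : ℝ), |t| ≤ l₀ → ∀ τ ∈ T K \ Bad K t, ∃ (c : ℝ) (g : GaugeField (F.P 0) 0 (SU N) → ℝ), Measurable g ∧ (∀ x, |g x| ≤ r K) ∧
      (classMeasureOfSlots F N ϑ.ν ϑ.τ9 (wOfRecord₉ F N ϑ) (pB K) (gB K) (Missing.boltzmann (F.P (pB K).K) ((g₀ (pB K).K)⁻¹ ^ 2))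
          (kB K) (eB K τ)).map ((T4RunLadder.unitFactorisation D hD g₀).A (pB K).K) =
        ENNReal.ofReal (Real.exp c) •
          ((classMeasureOfSlots F N ϑ.ν ϑ.τ9 (wOfRecord₉ F N ϑ) (pA K) (gA K) (Missing.boltzmann (F.P (pA K).K) ((g₀ (pA K).K)⁻¹ ^ 2))
            (kA K) (eA K τ)).map ((T4RunLadder.unitFactorisation D hD g₀).A (pA K).K)).withDensity fun x => ENNReal.ofReal (Real.exp (g x)))
    (hr : ∀ K, 0 ≤ r K) :
    TiltedMeanMatching l₀ T Bad (fun K => T4GenFunBounds.prodObs (D.scheme g₀) (pA K).K os)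
      (fun K τ => classMeasureOfSlots F N ϑ.ν ϑ.τ9 (wOfRecord₉ F N ϑ) (pA K) (gA K) (Missing.boltzmann (F.P (pA K).K) ((g₀ (pA K).K)⁻¹ ^ 2))
        (kA K) (eA K τ))
      (fun K => T4GenFunBounds.prodObs (D.scheme g₀) (pB K).K os)
      (fun K τ => classMeasureOfSlots F N ϑ.ν ϑ.τ9 (wOfRecord₉ F N ϑ) (pB K) (gB K) (Missing.boltzmann (F.P (pB K).K) ((g₀ (pB K).K)⁻¹ ^ 2))
        (kB K) (eB K τ)) r :=
  tiltedMeanMatching_of_shapeDensity_atKeys_linear (T4RunLadder.unitFactorisation D hD g₀) os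
    (mgfForm_classWeightOfDatum₉_of_ppSelId ϑ hsel hw0 hw1 hwm hχm D hD g₀ os pA gA kA T eA).finite hSh hr

end AtRecord

end Summit.QuantumFields.YangMills.BalabanUVNodes.N19ShapeFaceN14AtRecordSharp

end
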